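import Mathlib
import Summits.PneNP.PneNP.Theorems.ConvexRankGatesConvexGateBlindCatchTwo

/-!
# PneNP / ConvexRankGates — `ConvexGateBlind`: the catch bound with an abstract ℓ₁-constant

Helpers (`--supports stmt-PneNP-10680`), COLUMN-SPACE line (prover seat 2, session 16): the proof of
`…CatchTwo.card_badColourings_le_two` run with an ABSTRACT ℓ₁-constant `L` (hypothesis: `∑|v| ≤ L·∑v` for every
`k`-clique-non-negative `v`), so that any improvement of the ℓ₁-domination constant (unconditionally `2k²−4k+1`,
`…CliqueNonnegL1`; `400k−1` conditionally on Montgomery's theorem, `…L1Montgomery`; `> k−1` necessary, `…L1LowerBound`) feeds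
the catch bound directly: `#BAD ≤ q^m[exp(−(m−1)/(9216kL²)) + exp(−1/(5200√β))]`. [new]
-/

set_option linter.dupNamespace false

namespace Summit.PneNP.PneNP.Theorems

open Finset Real Literature.Computability.Complexity
open Summit.PneNP.PneNP.Cruxes.ConvexGateBlind.StrictRankConicCover (Edge)

noncomputable section

variable {m : ℕ}

/-- **Catch probability with an abstract ℓ₁-constant.** For `4 ≤ k`, `k + 2 ≤ m`, an ℓ₁-constant `L ≥ 1` valid for all
`k`-clique-non-negative weightings of `K_m` (`∑|v| ≤ L·∑v`), and a `k`-clique-non-negative `w`, the number of colourings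
`c : Fin m → Fin (k−1)` whose complete multipartite graph carries negative `w`-weight is at most
`(k−1)^m · exp(−(m−1)/(9216·k·L²)) + (k−1)^m · exp(−1/(5200·√β))`, `β = C(k,2)(k−2)/(m−k)`. [new] -/
theorem card_badColourings_le_of_l1 {k : ℕ} (hk : 4 ≤ k) (hm : k + 2 ≤ m) (L : ℝ) (hL1 : 1 ≤ L)
    (hl1 : ∀ v : Edge m → ℝ, (∀ Q ∈ (Finset.univ : Finset (Fin m)).powersetCard k, 0 ≤ softWindow v Q) →
      ∑ e, |v e| ≤ L * ∑ e, v e)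
    (w : Edge m → ℝ) (hw : ∀ Q ∈ (Finset.univ : Finset (Fin m)).powersetCard k, 0 ≤ softWindow w Q) :
    ((((Finset.univ : Finset (Fin m → Fin (k - 1))).filter fun c =>
        ∑ e, (if colorVec c e = true then w e else 0) < 0).card : ℝ)) ≤
      ((k - 1 : ℕ) : ℝ) ^ m * Real.exp (-(((m : ℝ) - 1) / (9216 * k * L ^ 2))) +
      ((k - 1 : ℕ) : ℝ) ^ m * Real.exp (-(1 / (5200 * Real.sqrt (((k : ℝ) * (k - 1) / 2) * ((k - 2) / (m - k)))))) := by
  classical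
  have hq3 : 3 ≤ k - 1 := by omega
  have hkR : (4 : ℝ) ≤ k := by exact_mod_cast hk
  have hmR : (k : ℝ) + 2 ≤ m := by exact_mod_cast hm
  have hmk : (0 : ℝ) < (m : ℝ) - k := by linarith
  have hBm0 : (0 : ℝ) < ((k : ℝ) - 2) / ((m : ℝ) - k) := div_pos (by linarith) hmk
  have hC2 : ((k.choose 2 : ℕ) : ℝ) = (k : ℝ) * (k - 1) / 2 := Nat.cast_choose_two ℝ k
  have hC2pos : (1 : ℝ) ≤ (k : ℝ) * (k - 1) / 2 := by nlinarith
  have hβ0 : (0 : ℝ) < ((k : ℝ) * (k - 1) / 2) * (((k : ℝ) - 2) / ((m : ℝ) - k)) := mul_pos (by linarith) hBm0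
  have hRHS0 : 0 ≤ ((k - 1 : ℕ) : ℝ) ^ m * Real.exp (-(((m : ℝ) - 1) / (9216 * k * L ^ 2))) +
      ((k - 1 : ℕ) : ℝ) ^ m * Real.exp (-(1 / (5200 * Real.sqrt (((k : ℝ) * (k - 1) / 2) * ((k - 2) / (m - k)))))) := by
    positivity
  -- Step 1: minimal reduction
  obtain ⟨v, hv, hvw, htight⟩ := exists_minimal_le (by omega : 2 ≤ k) (by omega : k ≤ m) w hw
  have hsub : ((Finset.univ : Finset (Fin m → Fin (k - 1))).filter fun c =>
        ∑ e, (if colorVec c e = true then w e else 0) < 0) ⊆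
      ((Finset.univ : Finset (Fin m → Fin (k - 1))).filter fun c =>
        ∑ e, (if colorVec c e = true then v e else 0) < 0) := by
    intro c hc
    rw [Finset.mem_filter] at hc ⊢
    exact ⟨hc.1, lt_of_le_of_lt (bichSum_mono hvw _) hc.2⟩
  refine le_trans (Nat.cast_le.2 (Finset.card_le_card hsub)) ?_
  -- Step 2: ℓ₁-domination and the total `W`
  obtain ⟨W, hW⟩ : ∃ W : ℝ, W = ∑ e, v e := ⟨_, rfl⟩
  have hl1 := hl1 v hv
  rw [← hW] at hl1
  by_cases hWpos : W ≤ 0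
  · -- then `v = 0` and no colouring is bad
    have habs0 : ∑ e, |v e| ≤ 0 := hl1.trans (by nlinarith)
    have hv0 : ∀ e, v e = 0 := by
      intro e
      have h := (Finset.sum_eq_zero_iff_of_nonneg (fun f _ => abs_nonneg (v f))).1
        (le_antisymm habs0 (Finset.sum_nonneg fun f _ => abs_nonneg (v f))) e (Finset.mem_univ e)
      exact abs_eq_zero.1 h
    have hempty : ((Finset.univ : Finset (Fin m → Fin (k - 1))).filter fun c =>
        ∑ e, (if colorVec c e = true then v e else 0) < 0) = ∅ := by
      refine Finset.filter_false_of_mem fun c _ => ?_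
      rw [not_lt]
      exact Finset.sum_nonneg fun e _ => by rw [hv0 e]; split_ifs <;> exact le_rfl
    rw [hempty, Finset.card_empty, Nat.cast_zero]
    exact hRHS0
  push Not at hWpos
  -- Step 3: entry bounds `v e ≤ βW`
  have hneg : ∀ e, -v e ≤ ((k : ℝ) - 2) / ((m : ℝ) - k) * W := by
    intro e
    have h := neg_entry_le_of_cliqueNonneg_at hk hm v hv e
    rw [← hW] at h
    linarith
  have hvle : ∀ e, v e ≤ ((k : ℝ) * (k - 1) / 2) * (((k : ℝ) - 2) / ((m : ℝ) - k)) * W := by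
    intro e
    by_cases hpos : 0 < v e
    · obtain ⟨Q, hQ, heQ, h0⟩ := htight e hpos
      rw [Finset.mem_powersetCard] at hQ
      have h := le_of_tight v hQ.2 h0 heQ hneg
      rw [hC2] at h
      nlinarith
    · push Not at hpos
      exact hpos.trans (by nlinarith [mul_pos hβ0 hWpos])
  -- Step 4: the symmetric matrix of `v`
  obtain ⟨V, hVdef⟩ : ∃ V : Fin m → Fin m → ℝ,
      V = fun x y => if h : x = y then 0 else v ⟨s(x, y), CliqueExtLowerBound.Negative.mk_mem_edgeSet_top h⟩ := ⟨_, rfl⟩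
  have hV0 : ∀ x, V x x = 0 := fun x => by rw [hVdef]; simp
  have hVoff : ∀ (x y : Fin m) (h : x ≠ y), V x y = v ⟨s(x, y), CliqueExtLowerBound.Negative.mk_mem_edgeSet_top h⟩ :=
    fun x y h => by rw [hVdef]; simp [h]
  have hVsym : ∀ x y, V x y = V y x := by
    intro x y
    by_cases h : x = y
    · rw [h]
    · rw [hVoff x y h, hVoff y x (Ne.symm h)]
      congr 1
      exact Subtype.ext Sym2.eq_swap
  have hVle : ∀ x y, V x y ≤ ((k : ℝ) * (k - 1) / 2) * (((k : ℝ) - 2) / ((m : ℝ) - k)) * W := by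
    intro x y
    by_cases h : x = y
    · rw [h, hV0]; exact (mul_pos hβ0 hWpos).le
    · rw [hVoff x y h]; exact hvle _
  -- Step 5: conversions
  have hmass : ∑ e, v e = (∑ x, ∑ y, V x y) / 2 := sum_edge_eq_half_sum_sum v V hV0 hVoff
  have habsmass : ∑ e, |v e| = (∑ x, ∑ y, |V x y|) / 2 :=
    sum_edge_eq_half_sum_sum (fun e => |v e|) (fun x y => |V x y|) (fun x => by rw [hV0, abs_zero])
      (fun x y h => by rw [hVoff x y h])
  have hmono : ∀ c : Fin m → Fin (k - 1), ∑ e, (if colorVec c e = false then v e else 0) =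
      (∑ x, ∑ y, if c x = c y then V x y else 0) / 2 := by
    intro c
    refine sum_edge_eq_half_sum_sum _ _ (fun x => by rw [if_pos rfl, hV0]) (fun x y h => ?_)
    by_cases hc : c x = c y
    · rw [if_pos hc, if_pos ((colorVec_mk_eq_false_iff c _).2 hc), hVoff x y h]
    · rw [if_neg hc, if_neg (fun h' => hc ((colorVec_mk_eq_false_iff c _).1 h'))]
  have hvalidM : ∀ Q ∈ (Finset.univ : Finset (Fin m)).powersetCard k, 0 ≤ ∑ x ∈ Q, ∑ y ∈ Q, V x y := by
    intro Q hQ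
    have h := hv Q hQ
    rw [softWindow_eq_half_sum_sum v V hV0 hVoff Q] at h
    linarith
  -- bad ⟹ monochromatic mass `> W`
  have hsub2 : ((Finset.univ : Finset (Fin m → Fin (k - 1))).filter fun c =>
        ∑ e, (if colorVec c e = true then v e else 0) < 0) ⊆
      ((Finset.univ : Finset (Fin m → Fin (k - 1))).filter fun c =>
        W < (∑ a, ∑ b, if c a = c b then V a b else 0) / 2) := by
    intro c hc
    rw [Finset.mem_filter] at hc ⊢
    refine ⟨hc.1, ?_⟩
    rw [← hmono c]
    have hsplit : ∑ e, v e = ∑ e, (if colorVec c e = true then v e else 0) +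
        ∑ e, (if colorVec c e = false then v e else 0) := by
      rw [← Finset.sum_add_distrib]
      refine Finset.sum_congr rfl fun e _ => ?_
      rcases Bool.eq_false_or_eq_true (colorVec c e) with h | h
      · rw [h]; simp
      · rw [h]; simp
    rw [hW, hsplit]
    linarith [hc.2]
  refine le_trans (Nat.cast_le.2 (Finset.card_le_card hsub2)) ?_
  have hdegsum : ∑ x, ∑ y, |V x y| ≤ 2 * L * W := by
    have : ∑ x, ∑ y, |V x y| = 2 * ∑ e, |v e| := by rw [habsmass]; ring
    rw [this]; nlinarith
  have hmass2 : ∑ x, ∑ y, V x y = 2 * W := by rw [hW, hmass]; ring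
  -- Step 6 (new): the hub set of all vertices of degree `≥ D = 8kLW/(m-1)`
  have hLpos : 0 < L := by linarith
  have hm1 : (0 : ℝ) < (m : ℝ) - 1 := by linarith
  obtain ⟨D, hD⟩ : ∃ D : ℝ, D = 8 * k * L * W / ((m : ℝ) - 1) := ⟨_, rfl⟩
  have hDpos : 0 < D := by rw [hD]; positivity
  obtain ⟨H, hH⟩ : ∃ H : Finset (Fin m), H = (Finset.univ : Finset (Fin m)).filter (fun x => D ≤ ∑ y, |V x y|) :=
    ⟨_, rfl⟩
  have hmemH : ∀ x, x ∈ H ↔ D ≤ ∑ y, |V x y| := fun x => by rw [hH, Finset.mem_filter]; simp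
  have hHdeg : ∀ x, x ∉ H → ∑ y, |V x y| ≤ D := by
    intro x hx
    by_contra hgt
    exact hx ((hmemH x).2 (not_le.1 hgt).le)
  have hdeg0 : ∀ x, 0 ≤ ∑ y, |V x y| := fun x => Finset.sum_nonneg fun y _ => abs_nonneg _
  have hHcard : (H.card : ℝ) ≤ ((m : ℝ) - 1) / (4 * k) := by
    have h1 : (H.card : ℝ) * D ≤ 2 * L * W := by
      calc (H.card : ℝ) * D = ∑ _x ∈ H, D := by rw [Finset.sum_const, nsmul_eq_mul]
        _ ≤ ∑ x ∈ H, ∑ y, |V x y| := Finset.sum_le_sum fun x hx => (hmemH x).1 hx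
        _ ≤ ∑ x, ∑ y, |V x y| :=
            Finset.sum_le_sum_of_subset_of_nonneg (Finset.subset_univ _) fun x _ _ => hdeg0 x
        _ ≤ 2 * L * W := hdegsum
    rw [hD] at h1
    rw [le_div_iff₀ (by positivity)]
    have h2 : (H.card : ℝ) * (8 * k * L * W) ≤ 2 * L * W * ((m : ℝ) - 1) := by
      have := mul_le_mul_of_nonneg_right h1 hm1.le
      rwa [mul_assoc, div_mul_cancel₀ _ hm1.ne'] at this
    have hLW : 0 < L * W := mul_pos hLpos hWpos
    nlinarith
  -- sizes: `#Hᶜ = m - #H ≥ k` and `(k-2)·#H/(#Hᶜ - 1) ≤ 1/4`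
  have hHc : ((Hᶜ).card : ℝ) = (m : ℝ) - H.card := by
    rw [Finset.card_compl, Fintype.card_fin, Nat.cast_sub (H.card_le_univ.trans_eq (Fintype.card_fin m))]
  have h4k : (H.card : ℝ) * (4 * k) ≤ (m : ℝ) - 1 := by
    have := hHcard; rwa [le_div_iff₀ (by positivity)] at this
  have hH0 : (0 : ℝ) ≤ H.card := Nat.cast_nonneg _
  have hH16 : (H.card : ℝ) * 16 ≤ (m : ℝ) - 1 :=
    le_trans (mul_le_mul_of_nonneg_left (by linarith) hH0) h4k
  have hHm : (H.card : ℝ) ≤ (m : ℝ) - k := by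
    have hmk2 : (2 : ℝ) ≤ (m : ℝ) - k := by linarith
    have hprod : (4 * (k : ℝ) - 1) * 2 ≤ (4 * (k : ℝ) - 1) * ((m : ℝ) - k) :=
      mul_le_mul_of_nonneg_left hmk2 (by linarith)
    have hkey : (m : ℝ) - 1 ≤ ((m : ℝ) - k) * (4 * k) := by linarith
    have hk0 : (0 : ℝ) < 4 * k := by positivity
    exact le_of_mul_le_mul_right (h4k.trans hkey) hk0
  have hS : k ≤ (Hᶜ).card := by
    have h1 : H.card + k ≤ m := by
      have : ((H.card + k : ℕ) : ℝ) ≤ m := by push_cast; linarith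
      exact_mod_cast this
    rw [Finset.card_compl, Fintype.card_fin]
    omega
  have hX : ((k : ℝ) - 2) * H.card / (((Hᶜ).card : ℝ) - 1) ≤ 1 / 4 := by
    rw [hHc]
    have hden : (0 : ℝ) < (m : ℝ) - H.card - 1 := by linarith
    rw [div_le_iff₀ hden]
    linarith
  -- the quarter hypothesis from the realisation lemma
  have hnegX := negMass_hub_le V hVsym hV0 hk hvalidM H hS (hX.trans (by norm_num))
  have hmassOut0 := massOut_nonneg V hVsym hV0 hk hvalidM H hS (hX.trans (by norm_num))
  have hneg4 : (∑ a ∈ H, ∑ b ∈ H, max (-V a b) 0) / 2 ≤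
      (1 / 4) * ((∑ x, ∑ y, V x y) / 2 - (∑ a ∈ H, ∑ b ∈ H, V a b) / 2) :=
    hnegX.trans (mul_le_mul_of_nonneg_right hX hmassOut0)
  -- the matrix theorem
  have hmain := card_monoMass_gt_le_two hq3 V hVsym hV0 hWpos hL1 hβ0 hDpos hdegsum hVle hmass2 H hHdeg hneg4
  have hexp : W / (1152 * D * L) = ((m : ℝ) - 1) / (9216 * k * L ^ 2) := by
    rw [hD]
    field_simp
    ring
  rw [hexp] at hmain
  exact hmain

/-- **Catch probability with an abstract ℓ₁-constant** (registered form of `card_badColourings_le_of_l1`). [new] -/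
theorem negCover_catch_of_l1 : ∀ {m k : ℕ}, 4 ≤ k → k + 2 ≤ m → ∀ (L : ℝ), 1 ≤ L → (∀ v : Edge m → ℝ, (∀ Q ∈ (Finset.univ : Finset (Fin m)).powersetCard k, 0 ≤ softWindow v Q) → ∑ e, |v e| ≤ L * ∑ e, v e) → ∀ (w : Edge m → ℝ), (∀ Q ∈ (Finset.univ : Finset (Fin m)).powersetCard k, 0 ≤ softWindow w Q) → ((((Finset.univ : Finset (Fin m → Fin (k - 1))).filter fun c => ∑ e, (if colorVec c e = true then w e else 0) < 0).card : ℝ)) ≤ ((k - 1 : ℕ) : ℝ) ^ m * Real.exp (-(((m : ℝ) - 1) / (9216 * k * L ^ 2))) + ((k - 1 : ℕ) : ℝ) ^ m * Real.exp (-(1 / (5200 * Real.sqrt (((k : ℝ) * (k - 1) / 2) * ((k - 2) / (m - k)))))) :=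
  fun hk hm L hL1 hl1 w hw => card_badColourings_le_of_l1 hk hm L hL1 hl1 w hw

end

end Summit.PneNP.PneNP.Theorems
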